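import Literature.AlgebraicGeometry.HodgeTheory.ArapuraSurfaceFibredFourfoldsProofs
import Literature.AlgebraicGeometry.Motives.ClosedSubvarietyOfPoint
import Literature.AlgebraicGeometry.Motives.CyclesDimensionProofs
import Literature.AlgebraicGeometry.Motives.HeightMorphism
import Literature.AlgebraicGeometry.Motives.OpenImmersionGraph
import Mathlib.AlgebraicGeometry.ZariskisMainTheorem
import HarnessLib

/-!
# A family of positive-dimensional supports in a surface family contains a divisor dominating
# the base

Topic `Literature/AlgebraicGeometry/HodgeTheory` (family `hodge`). One theorem (no definition, no
named fact; D-0026), the dimension count behind "the components of the relative Hilbert scheme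
… dominating `Y`" and "`𝒵_i → T_i` the universal families (of divisors)" in D. Arapura, *Hodge
cycles and the Leray filtration* (2022), proof of Cor. 1.5, and C. Voisin, *Hodge Theory II*
(2003), §11.2.1, on the tree's Hilbert-scheme-free carriers.

Let `q : V ⟶ B` be a proper morphism of smooth irreducible `ℂ`-schemes with
`dim V = dim B + 2` (a family of surfaces), and `W ⊊ V` a closed subset every fibre of which over
a complex point contains a point of positive dimension (a curve). Assume Chevalley's
semicontinuity in the form supplied by the tree's support families
(`SupportFamilyFibreDimensionLocus.exists_isClosed_pt_mem_iff_exists_height_ne_zero`): for every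
closed `C ⊆ W` the complex points `s` of `B` over which `C` has a point of positive dimension are
the complex points of a Zariski-closed subset. Then **some irreducible component `D` of `W` has
codimension one in `V` and maps ONTO `B`** (`exists_irreducible_coheight_one_image_eq_univ`).

Proof. Let `𝒞_1, …, 𝒞_r` be the irreducible components of `W` (`V` is Noetherian). Discard a
proper closed subset of `B`: the images of the non-dominating components, and, for each
dominating component of dimension `≤ dim B`, the closed set of complex points over which it has a
positive-dimensional point — proper, because such a component has finite generic fibre (its
points over `η_B` have dimension `≥ dim B ≥ dim 𝒞`, so coincide with `η_𝒞`), hence is finite over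
a neighbourhood of `η_B` (Stacks 02UP, Mathlib
`exists_isFinite_morphismRestrict_of_finite_preimage_singleton`), over whose complex points its
fibres are discrete (`Scheme.Hom.isDiscrete_preimage_singleton`) and so consist of closed points.
At a complex point `s` off this set (`exists_complexPoint_pt_not_mem`), the positive-dimensional
point of `W_s` lies on a dominating component `𝒞` of dimension `≥ dim B + 1 = dim V - 1`; as
`𝒞 ⊆ W ⊊ V`, `dim 𝒞 = dim V - 1`, i.e. `codim 𝒞 = 1` (`height + coheight = dim` on the smooth
irreducible `V`, `Motives.height_add_coheight_eq_of_smoothOfRelativeDimension`).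

## References

* [Arapura2022] D. Arapura, Hodge cycles and the Leray filtration, Pacific J. Math. 319 (2022),
  proof of Cor. 1.5 (p. 5).
* [VoisinHodgeII2003] C. Voisin, Hodge Theory and Complex Algebraic Geometry II (2003), §11.2.1.
* [EGAIV3] A. Grothendieck, J. Dieudonné, EGA IV₃ (1966), Thm. 13.1.3, Cor. 13.1.5.
* [StacksProject] The Stacks Project, Tag 02UP.
* [Hartshorne1977] R. Hartshorne, Algebraic Geometry (1977), II Ex. 3.20, Ex. 3.22.
-/

noncomputable section

open CategoryTheory AlgebraicGeometry Order Set
open _root_.Topology TopologicalSpace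

namespace Literature.AlgebraicGeometry.HodgeTheory

section HodgeTheory

variable {V B : Motives.SchemeOver ℂ}

/-- A point of a scheme of positive height (dimension of its closure) has a proper
specialisation. [folklore] -/
theorem exists_specializes_ne_of_height_ne_zero {X : Scheme} {x : X}
    (hx : height x ≠ 0) : ∃ y : X, x ⤳ y ∧ y ≠ x := by
  by_contra h
  push Not at h
  apply hx
  rw [Order.height_eq_zero]
  intro y hyx
  -- `y ≤ x` in the specialisation order means `x ⤳ y`
  rw [Scheme.le_iff_specializes] at hyx ⊢
  rw [h y hyx]

/-- **The irreducible generic point of an irreducible scheme has codimension `0`.** [folklore] -/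
private theorem coheight_genericPoint_eq_zero' (X : Scheme) [IrreducibleSpace X] :
    coheight (genericPoint X) = 0 := by
  rw [Order.coheight_eq_zero]
  intro y _
  -- `y ≤ genericPoint X` in the specialisation order: the generic point specialises to `y`
  rw [Scheme.le_iff_specializes]
  exact (genericPoint_spec X).specializes (mem_univ y)

/-- **A positive-dimensional family of curves in a family of surfaces contains a divisor onto the
base.** Let `q : V ⟶ B` be proper, `V` and `B` smooth irreducible over `ℂ` of dimensions `e + 2` and
`e`, `V` Noetherian; let `W ⊆ V` be closed, `W ≠ V`, such that over every complex point `s` of `B`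
the fibre `W_s` contains a point of positive dimension, and assume that for every closed `C ⊆ W`
the set of complex points of `B` over which `C` has a positive-dimensional point is cut out by a
closed subset of `B` (Chevalley, EGA IV₃ 13.1.5). Then there is an irreducible closed `D ⊆ W` of
codimension `1` in `V` (its generic point has `coheight = 1`) with `q(D) = B`.
[cite: Arapura2022, proof of Cor. 1.5 (p. 5)] [cite: EGAIV3, Thm. 13.1.3 and Cor. 13.1.5]
[cite: StacksProject, Tag 02UP] -/
theorem exists_irreducible_coheight_one_image_eq_univ (q : V ⟶ B) [IsProper q.left]
    {e : ℕ} [SmoothOfRelativeDimension (e + 2) V.hom] [IrreducibleSpace V.left]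
    [NoetherianSpace V.left] [SmoothOfRelativeDimension e B.hom] [IrreducibleSpace B.left]
    {W : Set V.left} (hW : IsClosed W) (hWV : W ≠ univ)
    (hpos : ∀ s : Motives.ComplexPoints B, ∃ x ∈ W, q.left.base x = s.pt ∧ height x ≠ 0)
    (hsemi : ∀ C : Set V.left, IsClosed C → C ⊆ W →
      ∃ C' : Set B.left, IsClosed C' ∧ ∀ s : Motives.ComplexPoints B,
        s.pt ∈ C' ↔ ∃ x ∈ C, q.left.base x = s.pt ∧ height x ≠ 0) :
    ∃ (D : Set V.left) (_ : IsClosed D) (hD : IsIrreducible D), D ⊆ W ∧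
      q.left.base '' D = univ ∧ coheight hD.genericPoint = 1 := by
  classical
  haveI : Smooth V.hom := SmoothOfRelativeDimension.smooth (n := e + 2) (f := V.hom)
  haveI : Smooth B.hom := SmoothOfRelativeDimension.smooth (n := e) (f := B.hom)
  haveI : LocallyOfFiniteType V.hom := inferInstance
  haveI : LocallyOfFiniteType B.hom := inferInstance
  haveI : LocallyOfFiniteType q.left := by
    haveI h : LocallyOfFiniteType (q.left ≫ B.hom) := by rw [Over.w q]; infer_instance
    exact locallyOfFiniteType_of_comp q.left B.hom
  -- dimension bookkeeping on `V` and `B`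
  have hdimV : ∀ z : V.left, height z + coheight z = ((e + 2 : ℕ) : ℕ∞) := fun z ↦
    Motives.height_add_coheight_eq_of_smoothOfRelativeDimension V.hom (e + 2) z
  have hdimB : ∀ z : B.left, height z + coheight z = (e : ℕ∞) := fun z ↦
    Motives.height_add_coheight_eq_of_smoothOfRelativeDimension B.hom e z
  have hfinV : ∀ z : V.left, height z < ⊤ := fun z ↦ by
    have h := hdimV z
    have h' : height z ≤ ((e + 2 : ℕ) : ℕ∞) := le_of_le_of_eq le_self_add h
    exact lt_of_le_of_lt h' (ENat.coe_lt_top _)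
  have hηB : height (genericPoint B.left) = (e : ℕ∞) := by
    have h := hdimB (genericPoint B.left)
    rwa [coheight_genericPoint_eq_zero', add_zero] at h
  have hηV : height (genericPoint V.left) = ((e + 2 : ℕ) : ℕ∞) := by
    have h := hdimV (genericPoint V.left)
    rwa [coheight_genericPoint_eq_zero', add_zero] at h
  -- heights do not increase along `q` (transcendence degrees)
  have hqh : ∀ x : V.left, height (q.left.base x) ≤ height x := fun x ↦ by
    haveI : LocallyOfFiniteType (q.left ≫ B.hom) := by rw [Over.w q]; infer_instance
    exact Motives.height_base_le_height q.left B.hom x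
  -- complex points of `B` are closed points
  have hspt : ∀ s : Motives.ComplexPoints B, IsClosed ({s.pt} : Set B.left) := fun s ↦
    Motives.OpenGraph.isClosed_singleton_pt s
  -- the irreducible components of `W`
  obtain ⟨S, hSfin, hScl, hSirr, hSW⟩ :=
    TopologicalSpace.NoetherianSpace.exists_finite_set_isClosed_irreducible hW
  -- every component is a proper closed subset of `V` of dimension `≤ e + 1`
  have hCsub : ∀ C ∈ S, C ⊆ W := fun C hC ↦ hSW ▸ subset_sUnion_of_mem hC
  have hCdim : ∀ C (hC : C ∈ S), height (hSirr C hC).genericPoint ≤ ((e + 1 : ℕ) : ℕ∞) := by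
    intro C hC
    set η := (hSirr C hC).genericPoint with hη
    have hηC : IsGenericPoint η C := (hSirr C hC).isGenericPoint_genericPoint (hScl C hC)
    have hne : η ≠ genericPoint V.left := by
      intro h
      apply hWV
      refine univ_subset_iff.1 ?_
      calc (univ : Set V.left) = closure {genericPoint V.left} := (genericPoint_closure V.left).symm
        _ = C := by rw [← h]; exact hηC
        _ ⊆ W := hCsub C hC
    have hgenη : genericPoint V.left ⤳ η := (genericPoint_spec V.left).specializes (mem_univ η)
    have hlt : η < genericPoint V.left := by
      rw [lt_iff_le_not_ge]
      refine ⟨?_, fun hge ↦ hne ?_⟩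
      · rw [Scheme.le_iff_specializes]
        exact hgenη
      · rw [Scheme.le_iff_specializes] at hge
        exact (hge.antisymm hgenη).eq
    have h1 : height η < height (genericPoint V.left) := height_strictMono hlt (hfinV η)
    rw [hηV] at h1
    have h2 : height η < (((e + 1 : ℕ) : ℕ∞)) + 1 := by
      rw [← Nat.cast_add_one]
      convert h1 using 2
    exact ENat.lt_add_one_iff (ENat.coe_ne_top _) |>.1 h2
  -- the bad set attached to a component
  have hbad : ∀ C (hC : C ∈ S), ∃ bad : Set B.left, IsClosed bad ∧ bad ≠ univ ∧
      ∀ s : Motives.ComplexPoints B, s.pt ∉ bad →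
        ∀ x ∈ C, q.left.base x = s.pt → height x ≠ 0 →
          q.left.base '' C = univ ∧ ((e + 1 : ℕ) : ℕ∞) ≤ height (hSirr C hC).genericPoint := by
    intro C hC
    set η := (hSirr C hC).genericPoint with hη
    have hηC : IsGenericPoint η C := (hSirr C hC).isGenericPoint_genericPoint (hScl C hC)
    have himcl : IsClosed (q.left.base '' C) := q.left.isClosedMap _ (hScl C hC)
    by_cases hdom : q.left.base '' C = univ
    swap
    · -- non-dominating: the image is the bad set
      exact ⟨q.left.base '' C, himcl, hdom, fun s hs x hxC hxs _ ↦ (hs ⟨x, hxC, hxs⟩).elim⟩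
    by_cases hbig : ((e + 1 : ℕ) : ℕ∞) ≤ height η
    · exact ⟨∅, isClosed_empty, empty_ne_univ, fun s _ x _ _ _ ↦ ⟨hdom, hbig⟩⟩
    · -- dominating and small: finite over a neighbourhood of `η_B`, so no positive-dimensional
      -- points over the complex points of that neighbourhood
      have hsmall : height η ≤ (e : ℕ∞) := by
        rw [not_le] at hbig
        rw [Nat.cast_add_one] at hbig
        exact ENat.lt_add_one_iff (ENat.coe_ne_top _) |>.1 hbig
      obtain ⟨C', hC'cl, hC'⟩ := hsemi C (hScl C hC) (hCsub C hC)
      -- the reduced closed subscheme `X₀ = closure {η} = C` and `g = ι ≫ q`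
      let X₀ : Motives.ClosedSubvariety V.left := Motives.ClosedSubvariety.ofPoint V.left η
      let g : X₀.carrier ⟶ B.left := X₀.ι ≫ q.left
      haveI : IsProper g := inferInstance
      have hrange : Set.range X₀.ι.base = C := by
        change Set.range (Motives.ClosedSubvariety.ofPoint V.left η).ι.base = C
        rw [Motives.ClosedSubvariety.range_ofPoint_ι]
        exact hηC
      -- the generic fibre of `g` is the generic point of `X₀`
      have hfib : (g.base ⁻¹' {genericPoint B.left}).Finite := by
        refine (Set.finite_singleton (genericPoint X₀.carrier)).subset fun c hc ↦ ?_
        have hc' : q.left.base (X₀.ι.base c) = genericPoint B.left := hc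
        have hcC : X₀.ι.base c ∈ C := hrange ▸ ⟨c, rfl⟩
        -- `height (ι c) ≥ e ≥ height η`, and `η ⤳ ι c`, so `ι c = η`
        have hge : (e : ℕ∞) ≤ height (X₀.ι.base c) := by
          rw [← hηB, ← hc']
          exact hqh _
        have hspec : η ⤳ X₀.ι.base c := hηC.specializes hcC
        have heq : X₀.ι.base c = η := by
          by_contra hne
          have hlt : X₀.ι.base c < η := by
            rw [lt_iff_le_not_ge]
            refine ⟨?_, fun hge ↦ hne ?_⟩
            · rw [Scheme.le_iff_specializes]
              exact hspec
            · rw [Scheme.le_iff_specializes] at hge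
              exact (hge.antisymm hspec).eq
          have h1 : height (X₀.ι.base c) < height η := height_strictMono hlt (hfinV _)
          exact absurd (hge.trans_lt (h1.trans_le hsmall)) (lt_irrefl _)
        have hgen : X₀.ι.base (genericPoint X₀.carrier) = η :=
          Motives.ClosedSubvariety.genericPoint_ofPoint (X := V.left) η
        have hinj : Function.Injective X₀.ι.base := X₀.ι.isClosedEmbedding.injective
        exact hinj (heq.trans hgen.symm)
      obtain ⟨O, hηO, hfinO⟩ :=
        exists_isFinite_morphismRestrict_of_finite_preimage_singleton g (genericPoint B.left) hfib
      -- over complex points of `O`, the fibres of `C` are discrete: no positive-dimensional point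
      have hgood : ∀ s : Motives.ComplexPoints B, s.pt ∈ O →
          ∀ x ∈ C, q.left.base x = s.pt → height x = 0 := by
        intro s hsO x hxC hxs
        by_contra hx0
        obtain ⟨y, hxy, hyx⟩ := exists_specializes_ne_of_height_ne_zero hx0
        have hyC : y ∈ C := hxy.mem_closed (hScl C hC) hxC
        have hys : q.left.base y = s.pt := by
          have h1 : q.left.base x ⤳ q.left.base y := hxy.map q.left.continuous
          rw [hxs] at h1
          exact ((hspt s).closure_eq ▸ h1.mem_closure : q.left.base y ∈ ({s.pt} : Set B.left))
        -- lift to `X₀` and to the open `g⁻¹ O`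
        obtain ⟨x', rfl⟩ : x ∈ Set.range X₀.ι.base := hrange ▸ hxC
        obtain ⟨y', rfl⟩ : y ∈ Set.range X₀.ι.base := hrange ▸ hyC
        have hx'y' : x' ⤳ y' := X₀.ι.isClosedEmbedding.isInducing.specializes_iff.1 hxy
        have hx'O : x' ∈ g ⁻¹ᵁ O := by
          change g.base x' ∈ O
          change q.left.base (X₀.ι.base x') ∈ O
          rw [hxs]; exact hsO
        have hy'O : y' ∈ g ⁻¹ᵁ O := by
          change q.left.base (X₀.ι.base y') ∈ O
          rw [hys]; exact hsO
        -- the restricted morphism is finite, hence locally quasi-finite with discrete fibres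
        haveI : LocallyQuasiFinite (g ∣_ O) := inferInstance
        have hdisc := (g ∣_ O).isDiscrete_preimage_singleton ⟨s.pt, hsO⟩
        haveI : DiscreteTopology ↥((g ∣_ O).base ⁻¹' {⟨s.pt, hsO⟩}) := hdisc.to_subtype
        have hgx : (g ∣_ O).base ⟨x', hx'O⟩ = ⟨s.pt, hsO⟩ := by
          apply Subtype.ext
          rw [morphismRestrict_base_coe]
          exact hxs
        have hgy : (g ∣_ O).base ⟨y', hy'O⟩ = ⟨s.pt, hsO⟩ := by
          apply Subtype.ext
          rw [morphismRestrict_base_coe]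
          exact hys
        have hsp : (⟨x', hx'O⟩ : ↥(g ⁻¹ᵁ O)) ⤳ ⟨y', hy'O⟩ :=
          (subtype_specializes_iff _ _).2 hx'y'
        have hsp' : (⟨⟨x', hx'O⟩, hgx⟩ : ↥((g ∣_ O).base ⁻¹' {⟨s.pt, hsO⟩})) ⤳ ⟨⟨y', hy'O⟩, hgy⟩ :=
          (subtype_specializes_iff _ _).2 hsp
        have heq := specializes_iff_eq.1 hsp'
        have heq' : x' = y' := congrArg (fun z ↦ (z.1 : ↥(g ⁻¹ᵁ O)).1) heq
        exact hyx (congrArg X₀.ι.base heq').symm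
      refine ⟨C', hC'cl, fun hC'u ↦ ?_, fun s hs x hxC hxs hx0 ↦ ?_⟩
      · -- `C' ≠ univ`: a complex point of the open `O` is not in `C'`
        obtain ⟨s, hs⟩ := exists_complexPoint_pt_not_mem (Y := B) O.isOpen.isClosed_compl
          (by
            intro h
            have : genericPoint B.left ∈ ((O : Set B.left)ᶜ) := h ▸ mem_univ _
            exact this hηO)
        have hsO : s.pt ∈ O := not_notMem.1 hs
        have hsC' : s.pt ∈ C' := hC'u ▸ mem_univ _
        obtain ⟨x, hxC, hxs, hx0⟩ := (hC' s).1 hsC'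
        exact hx0 (hgood s hsO x hxC hxs)
      · exact (hs ((hC' s).2 ⟨x, hxC, hxs, hx0⟩)).elim
  choose bad hbadcl hbadne hbadP using hbad
  -- the total bad set is a proper closed subset of the irreducible `B`
  haveI : Finite S := hSfin.to_subtype
  haveI : Fintype S := hSfin.fintype
  let badS : S → Set B.left := fun C ↦ bad C.1 C.2
  let Bad : Set B.left := ⋃ C : S, badS C
  have hBadcl : IsClosed Bad := isClosed_iUnion_of_finite fun C ↦ hbadcl C.1 C.2
  have hBadne : Bad ≠ univ := by
    intro hu
    have hirr := (IrreducibleSpace.isIrreducible_univ (X := B.left))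
    rw [isIrreducible_iff_sUnion_isClosed] at hirr
    have hcl : ∀ Z ∈ (Finset.univ : Finset S).image badS, IsClosed Z := by
      intro Z hZ
      obtain ⟨C, -, rfl⟩ := Finset.mem_image.1 hZ
      exact hbadcl C.1 C.2
    have hcov : (univ : Set B.left) ⊆ ⋃₀ ↑((Finset.univ : Finset S).image badS) := by
      rw [← hu]
      intro z hz
      obtain ⟨C, hzC⟩ := mem_iUnion.1 hz
      exact ⟨badS C, Finset.mem_coe.2 (Finset.mem_image.2 ⟨C, Finset.mem_univ _, rfl⟩), hzC⟩
    obtain ⟨Z, hZ, huZ⟩ := hirr _ hcl hcov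
    obtain ⟨C, -, rfl⟩ := Finset.mem_image.1 hZ
    exact hbadne C.1 C.2 (univ_subset_iff.1 huZ)
  obtain ⟨s, hs⟩ := exists_complexPoint_pt_not_mem (Y := B) hBadcl hBadne
  -- the positive-dimensional point over `s` and its component
  obtain ⟨x, hxW, hxs, hx0⟩ := hpos s
  have hxS : x ∈ ⋃₀ S := hSW ▸ hxW
  obtain ⟨C, hC, hxC⟩ := mem_sUnion.1 hxS
  have hsC : s.pt ∉ bad C hC := fun h ↦ hs (mem_iUnion.2 ⟨⟨C, hC⟩, h⟩)
  obtain ⟨hdom, hbig⟩ := hbadP C hC s hsC x hxC hxs hx0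
  refine ⟨C, hScl C hC, hSirr C hC, hCsub C hC, hdom, ?_⟩
  -- `height η_C = e + 1`, so `coheight η_C = 1`
  have hhe : height (hSirr C hC).genericPoint = ((e + 1 : ℕ) : ℕ∞) :=
    le_antisymm (hCdim C hC) hbig
  have h := hdimV (hSirr C hC).genericPoint
  rw [hhe] at h
  have hct : coheight (hSirr C hC).genericPoint ≠ ⊤ := by
    intro ht
    rw [ht, add_top] at h
    exact ENat.top_ne_coe _ h
  obtain ⟨m, hm⟩ := ENat.ne_top_iff_exists.1 hct
  rw [← hm] at h ⊢
  have h' : e + 1 + m = e + 2 := by exact_mod_cast h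
  have hm1 : m = 1 := by omega
  rw [hm1]
  rfl

end HodgeTheory

end Literature.AlgebraicGeometry.HodgeTheory

end
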